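import Literature.NumberTheory.LFunctions.RieszMeanPerron
import HarnessLib

/-!
# The Riesz (Cesàro) kernel of order two: `(1/2πi)∫_{(σ)} y^{-s} 2ds/(s(s+1)(s+2)) = ((1 − y)⁺)²`

Topic `Literature/NumberTheory/LFunctions`. Everything in this file is PROVED (no named facts).
Companion of `RieszMeanPerron.lean` (order one: `mellinInv_kernel_eq`,
`(1/2πi)∫_{(σ)} y^{-s} ds/(s(s+1)) = (1 − y)⁺`), in the Cesàro normalisation of Montgomery–Vaughan
§5.1, (5.17)–(5.19) with `k = 2`:

* `hasMellin_oneSubSq_indicator` — the Mellin pair `𝟙_{(0,1]}(y)(1 − y)² ↔ 2/(s(s+1)(s+2))`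
  (`Re s > 0`);
* `norm_rieszKernel₂_le`, `integrable_rieszKernel₂` — `‖2/(s(s+1)(s+2))‖ ≤ (2/(σ+2))/(σ² + t²)` on
  `Re s = σ > 0`, so the kernel is absolutely integrable on vertical lines;
* `mellinInv_rieszKernel₂_eq` — **the kernel evaluation**: for `σ > 0`, `y > 0`,
  `(1/2π) ∫ y^{−(σ+it)} 2dt/((σ+it)(σ+1+it)(σ+2+it)) = (max(1 − y, 0))²` (Mellin inversion,
  Mathlib `mellinInv_mellin_eq`).

The order-two kernel decays like `|t|^{−3}` on vertical lines, which is what makes Perron's formula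
for the smoothed sums `∑_n a_n n^{−s}(1 − n/N)²` of a Dirichlet series of finite order ABSOLUTELY
convergent after the contour is moved into the critical strip (used for Beurling zeta functions,
`Literature/NumberTheory/BeurlingPrimes/SmoothedZetaPerron.lean`).

## References
* [MontgomeryVaughan2007] H. L. Montgomery, R. C. Vaughan, *Multiplicative Number Theory I*, CUP 2007,
  §5.1, (5.17)–(5.19) (Riesz typical means / Cesàro weights of order `k`).
-/

noncomputable section

open Complex Filter Set MeasureTheory Real

namespace Literature.NumberTheory.LFunctions

/-! ## The Mellin pair `𝟙_{(0,1]}(1 − y)² ↔ 2/(s(s+1)(s+2))` -/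

/-- The Mellin transform of `f(y) = (1 − y)²·𝟙_{(0,1]}(y)` is `2/(s(s+1)(s+2))` for `Re s > 0`
(`(1 − y) − (y − y²)`, from `hasMellin_one_Ioc` and `hasMellin_cpow_Ioc 1, 2`).
[cite: MontgomeryVaughan2007, §5.1 (5.17)–(5.19)] -/
theorem hasMellin_oneSubSq_indicator {s : ℂ} (hs : 0 < s.re) :
    HasMellin ((Ioc 0 1).indicator fun y : ℝ ↦ ((1 : ℂ) - y) ^ 2) s (2 / (s * (s + 1) * (s + 2))) := by
  have h1 := hasMellin_one_Ioc hs
  have h2 := hasMellin_cpow_Ioc 1 (s := s) (by simp; linarith)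
  have h3 := hasMellin_cpow_Ioc 2 (s := s) (by simp; linarith)
  have hA := hasMellin_sub h1.1 h2.1
  have hB := hasMellin_sub h2.1 h3.1
  rw [h1.2, h2.2] at hA
  rw [h2.2, h3.2] at hB
  have hC := hasMellin_sub hA.1 hB.1
  rw [hA.2, hB.2] at hC
  have hs0 : s ≠ 0 := by rintro rfl; simp at hs
  have hs1 : s + 1 ≠ 0 := by
    intro h; have := congrArg Complex.re h; simp at this; linarith
  have hs2 : s + 2 ≠ 0 := by
    intro h; have := congrArg Complex.re h; simp at this; linarith
  have heq : (fun y : ℝ ↦ ((Ioc 0 1).indicator (fun _ : ℝ ↦ (1 : ℂ)) y -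
        (Ioc 0 1).indicator (fun t : ℝ ↦ (t : ℂ) ^ (1 : ℂ)) y) -
      ((Ioc 0 1).indicator (fun t : ℝ ↦ (t : ℂ) ^ (1 : ℂ)) y -
        (Ioc 0 1).indicator (fun t : ℝ ↦ (t : ℂ) ^ (2 : ℂ)) y)) =
      (Ioc 0 1).indicator fun y : ℝ ↦ ((1 : ℂ) - y) ^ 2 := by
    funext y
    by_cases hy : y ∈ Ioc (0 : ℝ) 1
    · simp only [Set.indicator_of_mem hy, cpow_one, cpow_two]
      ring
    · simp [Set.indicator_of_notMem hy]
  rw [heq] at hC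
  refine ⟨hC.1, ?_⟩
  rw [hC.2]
  field_simp
  ring

/-! ## The kernel `2/(s(s+1)(s+2))` on vertical lines `Re s = σ > 0` -/

/-- `‖(σ+it)(σ+1+it)(σ+2+it)‖ ≥ (σ² + t²)(σ + 2)` for `σ ≥ 0`. [folklore] -/
theorem sq_add_sq_mul_le_norm_kernel₂Den {σ : ℝ} (hσ : 0 ≤ σ) (t : ℝ) :
    (σ ^ 2 + t ^ 2) * (σ + 2) ≤ ‖((σ : ℂ) + t * I) * ((σ : ℂ) + t * I + 1) * ((σ : ℂ) + t * I + 2)‖ := by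
  rw [norm_mul]
  have h1 := sq_add_sq_le_norm_kernelDen hσ t
  have h2 : σ + 2 ≤ ‖(σ : ℂ) + t * I + 2‖ := by
    have := abs_re_le_norm ((σ : ℂ) + t * I + 2)
    have hre : ((σ : ℂ) + t * I + 2).re = σ + 2 := by simp
    rw [hre, abs_of_nonneg (by linarith)] at this
    exact this
  exact mul_le_mul h1 h2 (by linarith) (norm_nonneg _)

/-- The order-two kernel is bounded by `(2/(σ+2))/(σ² + t²)` on `Re s = σ > 0`. [folklore] -/
theorem norm_rieszKernel₂_le {σ : ℝ} (hσ : 0 < σ) (t : ℝ) :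
    ‖2 / (((σ : ℂ) + t * I) * ((σ : ℂ) + t * I + 1) * ((σ : ℂ) + t * I + 2))‖ ≤
      2 / (σ + 2) * (1 / (σ ^ 2 + t ^ 2)) := by
  rw [norm_div, Complex.norm_ofNat]
  have h := sq_add_sq_mul_le_norm_kernel₂Den hσ.le t
  have hpos : 0 < (σ ^ 2 + t ^ 2) * (σ + 2) := by positivity
  calc 2 / ‖((σ : ℂ) + t * I) * ((σ : ℂ) + t * I + 1) * ((σ : ℂ) + t * I + 2)‖
      ≤ 2 / ((σ ^ 2 + t ^ 2) * (σ + 2)) := div_le_div_of_nonneg_left (by norm_num) hpos h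
    _ = 2 / (σ + 2) * (1 / (σ ^ 2 + t ^ 2)) := by field_simp

/-- The denominator does not vanish on `Re s = σ > 0`. [folklore] -/
theorem kernel₂Den_ne_zero {σ : ℝ} (hσ : 0 < σ) (t : ℝ) :
    ((σ : ℂ) + t * I) * ((σ : ℂ) + t * I + 1) * ((σ : ℂ) + t * I + 2) ≠ 0 := by
  intro h
  have := sq_add_sq_mul_le_norm_kernel₂Den hσ.le t
  rw [h, norm_zero] at this
  have : 0 < (σ ^ 2 + t ^ 2) * (σ + 2) := by positivity
  linarith

/-- The kernel `t ↦ 2/((σ+it)(σ+1+it)(σ+2+it))` is integrable on `ℝ` for `σ > 0`. [folklore] -/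
theorem integrable_rieszKernel₂ {σ : ℝ} (hσ : 0 < σ) :
    Integrable fun t : ℝ ↦ 2 / (((σ : ℂ) + t * I) * ((σ : ℂ) + t * I + 1) * ((σ : ℂ) + t * I + 2)) := by
  refine ((integrable_inv_sq_add_sq hσ).const_mul (2 / (σ + 2))).mono' ?_
    (Eventually.of_forall fun t ↦ norm_rieszKernel₂_le hσ t)
  refine Continuous.aestronglyMeasurable ?_
  exact Continuous.div continuous_const (by fun_prop) (kernel₂Den_ne_zero hσ)

/-! ## The kernel evaluation -/

/-- **The Perron kernel of order two.** For `σ > 0` and `y > 0`,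
`(1/2π) ∫_{−∞}^{∞} y^{−(σ+it)} 2dt/((σ+it)(σ+1+it)(σ+2+it)) = ((1 − y)⁺)²`, i.e.
`(1/2πi) ∫_{(σ)} y^{−s} 2ds/(s(s+1)(s+2)) = (max(1 − y, 0))²` (Montgomery–Vaughan (5.19) with `k = 2`,
in the variable `1/y`; here by Mellin inversion, `mellinInv_mellin_eq`).
[cite: MontgomeryVaughan2007, §5.1 (5.19)] -/
theorem mellinInv_rieszKernel₂_eq {σ : ℝ} (hσ : 0 < σ) {y : ℝ} (hy : 0 < y) :
    mellinInv σ (fun s ↦ 2 / (s * (s + 1) * (s + 2))) y = (((max (1 - y) 0) ^ 2 : ℝ) : ℂ) := by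
  set f : ℝ → ℂ := (Ioc 0 1).indicator fun y : ℝ ↦ ((1 : ℂ) - y) ^ 2 with hf
  have hmel : ∀ t : ℝ, mellin f (σ + t * I) =
      2 / ((σ + t * I) * (σ + t * I + 1) * (σ + t * I + 2)) := fun t ↦
    (hasMellin_oneSubSq_indicator (s := σ + t * I) (by simpa using hσ)).2
  have hconv : MellinConvergent f σ :=
    (hasMellin_oneSubSq_indicator (s := σ) (by simpa using hσ)).1
  have hvert : VerticalIntegrable (mellin f) σ := by
    unfold VerticalIntegrable
    exact (integrable_rieszKernel₂ hσ).congr (Eventually.of_forall fun t ↦ (hmel t).symm)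
  have hfeq : ∀ u : ℝ, 0 < u → f u = (((max (1 - u) 0) ^ 2 : ℝ) : ℂ) := by
    intro u hu
    by_cases hu1 : u ≤ 1
    · rw [hf, Set.indicator_of_mem (show u ∈ Ioc (0 : ℝ) 1 from ⟨hu, hu1⟩),
        max_eq_left (by linarith)]
      push_cast; ring
    · rw [hf, Set.indicator_of_notMem (show u ∉ Ioc (0 : ℝ) 1 from fun h ↦ hu1 h.2),
        max_eq_right (by linarith)]
      simp
  have hcont : ContinuousAt f y := by
    have hev : f =ᶠ[nhds y] fun u ↦ (((max (1 - u) 0) ^ 2 : ℝ) : ℂ) := by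
      filter_upwards [Ioi_mem_nhds hy] with u hu
      exact hfeq u hu
    refine (ContinuousAt.congr ?_ hev.symm)
    exact (Complex.continuous_ofReal.comp (((continuous_const.sub continuous_id).max
      continuous_const).pow 2)).continuousAt
  have hinv := mellinInv_mellin_eq σ f hy hconv hvert hcont
  rw [hfeq y hy] at hinv
  rw [← hinv]
  unfold mellinInv
  congr 1
  refine integral_congr_ae (Eventually.of_forall fun t ↦ ?_)
  simp only [hmel t]

end Literature.NumberTheory.LFunctions

end
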